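import Mathlib
import HarnessLib
import Summits.HubbardSuperconductivity.HubbardSuperconductivity.Theorems.KLProgrammeKLRegimeWickCollapseBridge

/-!
# Route `KLProgramme` — ENGINE child (E2-v9): the `n`-fold WICK MOMENT FORMULA on the tree's replica layer `Fin n × Γ`
# (E2-WICK-ROADMAP §5 (i), first half; cell gate-hubbard-kl, seat p1 g8)

The `n`-copy generalisation of `wickStar_eq_dblFold_gaussConv_cross` (p483614), in the TREE's replica convention (`GrassmannCollapse`: labels
`Fin n × Γ`, fold = `collapse R Prod.snd`).  For a covariance `C` (integrated), `D` (kept), and EVEN elements `w_a` (`a : Fin n`):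

  `e^{Δ_D} ( e^{Δ_C} ( ∏_a e^{−Δ_{D+C}} w_a ) ) = collapse snd ( e^{Δ_{offCov (D+C)}} ( ∏_a copy_a w_a ) )`        (`wickMoment_eq_collapse`)

— the `n`-th WICK MOMENT (the plain moment of Wick-ordered vertices, re-smeared by the soft covariance) collects only contractions BETWEEN
distinct replicas, with covariance `D + C` on every inter-replica pair; NO line inside a replica.  (The Wick CUMULANT is the ursell/inclusion–exclusion
combination of these over the `C`-blocks — second half, on `GrassmannLaplacianTreeExpansion`'s `treeOp`.)

* §1 replica copy homs `replicaCopy a : 𝒜(Γ) →ₐ 𝒜(Fin n × Γ)` (`ψ_X ↦ ψ_{(a,X)}`; the tree builds replicas kernel-wise only), `collapse snd ∘ replicaCopy a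
  = id`, supports, parity; block covariances `blkCov C a b`, `allCov C = C.submatrix snd snd` (the tree's replica-blind covariance), `diagCov`, `offCov`,
  `allCov = diagCov + offCov`;
* §2 transport `gaussConv_collapse_snd` (`e^{Δ_C}∘collapse = collapse∘e^{Δ_{allCov C}}`), `gaussConv_blkCov_replicaCopy`, and the KEY LEMMA
  **`gaussConv_diagCov_prod_replicaCopy`**: `e^{Δ_{diagCov C'}} (∏_a copy_a w_a) = ∏_a copy_a (e^{Δ_{C'}} w_a)` for even `w_a` (the diagonal blocks act
  replica by replica; product in the commutative `evenPart`);
* §3 **`wickMoment_eq_collapse`**.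

Generic (commutative `ℚ`-algebra `R`, finite `Γ`); proved; definitions = the replica gadgets (bodies only); nothing about the model is asserted.
-/

noncomputable section

namespace Summit.HubbardSuperconductivity.HubbardSuperconductivity.Theorems.KLRegimeWick

set_option linter.dupNamespace false -- summit = problem name (single-conjunct summit), D-0017

open Literature.MathematicalPhysics.QuantumLattice GrassmannAlgebra Finset Matrix

section Replica

variable (R : Type*) [CommRing R] {Γ : Type*} [Fintype Γ] [DecidableEq Γ] {n : ℕ}

/-! ## §1 Replica copies and block covariances on `Fin n × Γ` -/

/-- The matrix of the copy-`a` substitution `ψ_X ↦ ψ_{(a,X)}`. -/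
def replicaEmbMat (a : Fin n) : Matrix (Fin n × Γ) Γ R := Matrix.of fun p X => if p = (a, X) then 1 else 0

/-- **Replica copy `a`** `𝒜(Γ) →ₐ 𝒜(Fin n × Γ)`: `ψ_X ↦ ψ_{(a,X)}`. -/
def replicaCopy (a : Fin n) : GrassmannAlgebra R Γ →ₐ[R] GrassmannAlgebra R (Fin n × Γ) :=
  ExteriorAlgebra.map (Matrix.toLin' (replicaEmbMat R (Γ := Γ) a))

/-- The `(a,b)` block of a covariance on the replica labels. -/
def blkCov (C : Matrix Γ Γ R) (a b : Fin n) : Matrix (Fin n × Γ) (Fin n × Γ) R :=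
  Matrix.of fun p q => if p.1 = a ∧ q.1 = b then C p.2 q.2 else 0

/-- The replica-blind covariance (ALL blocks `= C`; the tree's `C.submatrix Prod.snd Prod.snd`). -/
def allCov (C : Matrix Γ Γ R) : Matrix (Fin n × Γ) (Fin n × Γ) R := Matrix.of fun p q => C p.2 q.2

/-- The diagonal blocks. -/
def diagCov (C : Matrix Γ Γ R) : Matrix (Fin n × Γ) (Fin n × Γ) R := Matrix.of fun p q => if p.1 = q.1 then C p.2 q.2 else 0

/-- The off-diagonal blocks (inter-replica pairs only). -/
def offCov (C : Matrix Γ Γ R) : Matrix (Fin n × Γ) (Fin n × Γ) R := Matrix.of fun p q => if p.1 = q.1 then 0 else C p.2 q.2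

omit [Fintype Γ] [DecidableEq Γ] in
/-- `allCov = diagCov + offCov`. -/
theorem allCov_eq_diag_add_off (C : Matrix Γ Γ R) : allCov R (n := n) C = diagCov R C + offCov R C := by
  ext p q
  simp only [allCov, diagCov, offCov, Matrix.of_apply, Matrix.add_apply]
  split_ifs <;> simp

omit [CommRing R] [Fintype Γ] [DecidableEq Γ] in
/-- `allCov C` is the tree's replica-blind covariance `C.submatrix Prod.snd Prod.snd`. -/
theorem allCov_eq_submatrix (C : Matrix Γ Γ R) : allCov R (n := n) C = C.submatrix Prod.snd Prod.snd := rfl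

omit [Fintype Γ] [DecidableEq Γ] in
/-- `diagCov = Σ_a blkCov a a`. -/
theorem diagCov_eq_sum (C : Matrix Γ Γ R) : diagCov R (n := n) C = ∑ a : Fin n, blkCov R C a a := by
  ext p q
  simp only [diagCov, blkCov, Matrix.of_apply, Matrix.sum_apply]
  by_cases h : p.1 = q.1
  · rw [if_pos h, Finset.sum_eq_single p.1 (fun a _ ha => by rw [if_neg (fun hh => ha hh.1.symm)]) (fun hp => absurd (mem_univ _) hp),
      if_pos ⟨rfl, h.symm⟩]
  · rw [if_neg h]
    exact (Finset.sum_eq_zero fun a _ => by rw [if_neg (fun hh => h (hh.1.trans hh.2.symm))]).symm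

/-- `collapse snd ∘ replicaCopy a = id`: the substitution matrices compose to `1`. -/
theorem collapseLM_comp_toLin'_replicaEmbMat (a : Fin n) :
    (collapseLM R (Prod.snd : Fin n × Γ → Γ)).comp (Matrix.toLin' (replicaEmbMat R (Γ := Γ) a)) = LinearMap.id := by
  apply LinearMap.ext
  intro v
  funext X
  rw [LinearMap.comp_apply, collapseLM_apply, LinearMap.id_apply]
  simp only [Matrix.toLin'_apply, Matrix.mulVec, dotProduct, replicaEmbMat, Matrix.of_apply, ite_mul, one_mul, zero_mul]
  rw [Finset.sum_eq_single (a, X)]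
  · simp
  · rintro ⟨b, Y⟩ hq hne
    simp only [mem_filter, mem_univ, true_and] at hq
    subst hq
    exact Finset.sum_eq_zero fun Z _ => by
      rw [if_neg]
      rintro ⟨rfl, rfl⟩
      exact hne rfl
  · intro h
    exact absurd (by simp) h

/-- **`collapse snd (replicaCopy a x) = x`.** -/
theorem collapse_replicaCopy (a : Fin n) (x : GrassmannAlgebra R Γ) :
    collapse R (Prod.snd : Fin n × Γ → Γ) (replicaCopy R a x) = x := by
  have h : (collapse R (Prod.snd : Fin n × Γ → Γ)).comp (replicaCopy R a) = AlgHom.id R _ := by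
    rw [collapse, replicaCopy, ExteriorAlgebra.map_comp_map, collapseLM_comp_toLin'_replicaEmbMat, ExteriorAlgebra.map_id]
  exact congrArg (fun φ : GrassmannAlgebra R Γ →ₐ[R] GrassmannAlgebra R Γ => φ x) h

/-- `replicaCopy a (ψ_X) = ψ_{(a,X)}`. -/
theorem replicaCopy_gen (a : Fin n) (X : Γ) : replicaCopy R a (gen R X) = gen R ((a, X) : Fin n × Γ) := by
  rw [replicaCopy, gen, ExteriorAlgebra.map_apply_ι, gen, Matrix.toLin'_apply, Matrix.mulVec_single]
  congr 1
  ext p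
  simp only [MulOpposite.op_one, Pi.smul_apply, Matrix.col_apply, replicaEmbMat, Matrix.of_apply, one_smul, Pi.single_apply]

/-- The replica copy `a` of any element is supported on the labels of replica `a`. -/
theorem replicaCopy_mem_fieldSubalgebra (a : Fin n) (x : GrassmannAlgebra R Γ) :
    replicaCopy R a x ∈ fieldSubalgebra R {p : Fin n × Γ | p.1 = a} := by
  induction x using ExteriorAlgebra.induction with
  | algebraMap r => rw [AlgHom.commutes]; exact Subalgebra.algebraMap_mem _ r
  | ι v =>
    have hv : (ExteriorAlgebra.ι R v : GrassmannAlgebra R Γ) = ∑ X, v X • gen R X := by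
      conv_lhs => rw [show v = ∑ X, v X • (Pi.single X 1 : Γ → R) from by
        ext Y; simp [Finset.sum_apply, Pi.single_apply]]
      rw [map_sum]
      simp only [map_smul, gen]
    rw [hv, map_sum]
    refine Subalgebra.sum_mem _ fun X _ => ?_
    rw [map_smul, replicaCopy_gen]
    exact Subalgebra.smul_mem _ (gen_mem_fieldSubalgebra R (by exact rfl)) _
  | mul x y hx hy => rw [map_mul]; exact Subalgebra.mul_mem _ hx hy
  | add x y hx hy => rw [map_add]; exact Subalgebra.add_mem _ hx hy

/-- The replica copy of any element is supported away from every OTHER replica `b ≠ a`. -/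
theorem replicaCopy_mem_fieldSubalgebra_ne {a b : Fin n} (hab : a ≠ b) (x : GrassmannAlgebra R Γ) :
    replicaCopy R a x ∈ fieldSubalgebra R {p : Fin n × Γ | p.1 ≠ b} := by
  refine fieldSubalgebra_mono R ?_ (replicaCopy_mem_fieldSubalgebra R a x)
  intro p hp
  simp only [Set.mem_setOf_eq] at hp ⊢
  exact fun h => hab (hp.symm.trans h)

/-- Replica copies of even elements are even. -/
theorem replicaCopy_mem_evenOdd_zero (a : Fin n) {x : GrassmannAlgebra R Γ} (hx : x ∈ evenOdd R 0) :
    replicaCopy R a x ∈ evenOdd R 0 :=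
  map_mem_evenOdd_zero R _ hx

/-- The replica copy on the even part (an even element of the replica algebra). -/
def replicaCopyEven (a : Fin n) (w : evenPart R Γ) : evenPart R (Fin n × Γ) :=
  ⟨replicaCopy R a w, (mem_evenPart_iff).2 (replicaCopy_mem_evenOdd_zero R a ((mem_evenPart_iff).1 w.2))⟩

/-- Coercion of `replicaCopyEven`. -/
@[simp] theorem coe_replicaCopyEven (a : Fin n) (w : evenPart R Γ) :
    (replicaCopyEven R a w : GrassmannAlgebra R (Fin n × Γ)) = replicaCopy R a w := rfl

/-! ## §2 Transport of the Gaussian convolution -/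

/-- The collapse pulls a covariance back to ALL blocks. -/
theorem collapseLM_transpose_mul_mul (C : Matrix Γ Γ R) :
    ((LinearMap.toMatrix' (collapseLM R (Prod.snd : Fin n × Γ → Γ))).transpose * C *
        LinearMap.toMatrix' (collapseLM R (Prod.snd : Fin n × Γ → Γ)) : Matrix (Fin n × Γ) (Fin n × Γ) R) = allCov R C := by
  have hM : ∀ (X : Γ) (q : Fin n × Γ), LinearMap.toMatrix' (collapseLM R (Prod.snd : Fin n × Γ → Γ)) X q = if q.2 = X then 1 else 0 := by
    intro X q
    rw [LinearMap.toMatrix'_apply, collapseLM_apply]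
    simp only [Pi.single_apply, Finset.sum_ite_eq', Finset.mem_filter, Finset.mem_univ, true_and]
  ext p q
  rw [Matrix.mul_apply]
  simp only [Matrix.mul_apply, Matrix.transpose_apply, hM, allCov, Matrix.of_apply, ite_mul, one_mul, zero_mul, mul_ite, mul_one,
    mul_zero, Finset.sum_ite_eq, Finset.mem_univ, if_true]

/-- A replica copy pulls a replica covariance back to its diagonal block. -/
theorem replicaEmbMat_transpose_mul_mul (a : Fin n) (C' : Matrix (Fin n × Γ) (Fin n × Γ) R) :
    ((replicaEmbMat R (Γ := Γ) a).transpose * C' * replicaEmbMat R (Γ := Γ) a : Matrix Γ Γ R) = Matrix.of fun X Y => C' (a, X) (a, Y) := by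
  ext X Y
  rw [Matrix.mul_apply]
  simp only [Matrix.mul_apply, Matrix.transpose_apply, replicaEmbMat, Matrix.of_apply, ite_mul, one_mul, zero_mul, mul_ite, mul_one,
    mul_zero, Finset.sum_ite_eq', Finset.mem_univ, if_true]

/-- … in particular the diagonal block `blkCov C a a` pulls back to `C`. -/
theorem replicaEmbMat_transpose_mul_blkCov_mul (a : Fin n) (C : Matrix Γ Γ R) :
    ((replicaEmbMat R (Γ := Γ) a).transpose * blkCov R C a a * replicaEmbMat R (Γ := Γ) a : Matrix Γ Γ R) = C := by
  rw [replicaEmbMat_transpose_mul_mul]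
  ext X Y
  simp [blkCov]

variable [Algebra ℚ R]

/-- **`e^{Δ_C} (collapse snd F) = collapse snd (e^{Δ_{allCov C}} F)`.** -/
theorem gaussConv_collapse_snd (C : Matrix Γ Γ R) (F : GrassmannAlgebra R (Fin n × Γ)) :
    gaussConv R C (collapse R (Prod.snd : Fin n × Γ → Γ) F) = collapse R Prod.snd (gaussConv R (allCov R C) F) := by
  rw [collapse, gaussConv_map, collapseLM_transpose_mul_mul]

/-- **`e^{Δ_{blkCov C a a}} (replicaCopy a x) = replicaCopy a (e^{Δ_C} x)`.** -/
theorem gaussConv_blkCov_replicaCopy (a : Fin n) (C : Matrix Γ Γ R) (x : GrassmannAlgebra R Γ) :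
    gaussConv R (blkCov R C a a) (replicaCopy R a x) = replicaCopy R a (gaussConv R C x) := by
  rw [replicaCopy, gaussConv_map, LinearMap.toMatrix'_toLin', replicaEmbMat_transpose_mul_blkCov_mul]

omit [Fintype Γ] [DecidableEq Γ] [Algebra ℚ R] in
/-- The block `blkCov C a a` charges no label off replica `a`. -/
theorem blkCov_eq_zero_of_ne (C : Matrix Γ Γ R) (a : Fin n) (p q : Fin n × Γ)
    (h : p ∈ {p : Fin n × Γ | p.1 ≠ a} ∨ q ∈ {p : Fin n × Γ | p.1 ≠ a}) : blkCov R C a a p q = 0 := by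
  simp only [Set.mem_setOf_eq] at h
  rw [blkCov, Matrix.of_apply, if_neg]
  rintro ⟨hp, hq⟩
  rcases h with h | h
  · exact h hp
  · exact h hq

omit [Algebra ℚ R] in
/-- The product of replica copies over a set of replicas NOT containing `a` is supported away from replica `a`. -/
theorem coe_prod_replicaCopyEven_mem (w : Fin n → evenPart R Γ) {S : Finset (Fin n)} {a : Fin n} (ha : a ∉ S) :
    ((∏ b ∈ S, replicaCopyEven R b (w b) : evenPart R (Fin n × Γ)) : GrassmannAlgebra R (Fin n × Γ)) ∈
      fieldSubalgebra R {p : Fin n × Γ | p.1 ≠ a} :=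
  coe_prod_mem _ _ S fun b hb => replicaCopy_mem_fieldSubalgebra_ne R (fun h => ha (by rw [← h]; exact hb)) _

/-- **KEY LEMMA — the diagonal blocks act replica by replica**: for even `w_a`,
`e^{Δ_{blkCov C a a}} (∏_{b ∈ S} copy_b w_b) = ∏_{b ∈ S} copy_b (w_b or e^{Δ_C} w_b)` (the `a`-th factor convolved, the others untouched). -/
theorem gaussConv_blkCov_prod_replicaCopyEven (C : Matrix Γ Γ R) (w : Fin n → evenPart R Γ) (a : Fin n) (S : Finset (Fin n)) :
    gaussConv R (blkCov R C a a) ((∏ b ∈ S, replicaCopyEven R b (w b) : evenPart R (Fin n × Γ)) : GrassmannAlgebra R (Fin n × Γ)) =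
      ((∏ b ∈ S, replicaCopyEven R b (if b = a then ⟨gaussConv R C (w b), (mem_evenPart_iff).2
          (gaussConv_mem_evenOdd R C ((mem_evenPart_iff).1 (w b).2))⟩ else w b) : evenPart R (Fin n × Γ)) :
        GrassmannAlgebra R (Fin n × Γ)) := by
  by_cases ha : a ∈ S
  · -- isolate the `a`-th factor: `∏_S = copy_a w_a * ∏_{S \ a}`
    rw [← Finset.mul_prod_erase S _ ha, ← Finset.mul_prod_erase S _ ha]
    simp only [Subalgebra.coe_mul, coe_replicaCopyEven, if_true]
    have hrest : ∀ (w' : Fin n → evenPart R Γ),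
        ((∏ b ∈ S.erase a, replicaCopyEven R b (w' b) : evenPart R (Fin n × Γ)) : GrassmannAlgebra R (Fin n × Γ)) ∈
          fieldSubalgebra R {p : Fin n × Γ | p.1 ≠ a} := fun w' =>
      coe_prod_replicaCopyEven_mem R w' (Finset.notMem_erase a S)
    rw [gaussConv_mul_eq_mul_of_mem_right R (blkCov R C a a) (fun p q h => blkCov_eq_zero_of_ne R C a p q h) _ (hrest w),
      gaussConv_blkCov_replicaCopy]
    congr 2
    exact Finset.prod_congr rfl fun b hb => by rw [if_neg (Finset.ne_of_mem_erase hb)]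
  · -- `a ∉ S`: nothing to convolve
    have hS : ((∏ b ∈ S, replicaCopyEven R b (w b) : evenPart R (Fin n × Γ)) : GrassmannAlgebra R (Fin n × Γ)) ∈
        fieldSubalgebra R {p : Fin n × Γ | p.1 ≠ a} := coe_prod_replicaCopyEven_mem R w ha
    have h1 := gaussConv_mul_eq_mul_of_mem_right R (blkCov R C a a) (fun p q h => blkCov_eq_zero_of_ne R C a p q h) 1 hS
    rw [one_mul, gaussConv_one, one_mul] at h1
    rw [h1]
    congr 1
    exact Finset.prod_congr rfl fun b hb => by rw [if_neg (fun h => ha (by rw [← h]; exact hb))]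

/-- **The diagonal blocks undo the Wick ordering replica by replica**:
`e^{Δ_{diagCov C}} (∏_a copy_a w_a) = ∏_a copy_a (e^{Δ_C} w_a)` for even `w_a`. -/
theorem gaussConv_diagCov_prod_replicaCopyEven (C : Matrix Γ Γ R) (w : Fin n → evenPart R Γ) :
    gaussConv R (diagCov R C) ((∏ a, replicaCopyEven R a (w a) : evenPart R (Fin n × Γ)) : GrassmannAlgebra R (Fin n × Γ)) =
      ((∏ a, replicaCopyEven R a ⟨gaussConv R C (w a), (mem_evenPart_iff).2
          (gaussConv_mem_evenOdd R C ((mem_evenPart_iff).1 (w a).2))⟩ : evenPart R (Fin n × Γ)) : GrassmannAlgebra R (Fin n × Γ)) := by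
  -- peel the blocks one by one: after the blocks in `T`, the factors in `T` are convolved
  suffices h : ∀ T : Finset (Fin n),
      gaussConv R (∑ a ∈ T, blkCov R C a a) ((∏ a, replicaCopyEven R a (w a) : evenPart R (Fin n × Γ)) : GrassmannAlgebra R (Fin n × Γ)) =
        ((∏ a, replicaCopyEven R a (if a ∈ T then ⟨gaussConv R C (w a), (mem_evenPart_iff).2
            (gaussConv_mem_evenOdd R C ((mem_evenPart_iff).1 (w a).2))⟩ else w a) : evenPart R (Fin n × Γ)) :
          GrassmannAlgebra R (Fin n × Γ)) by
    rw [diagCov_eq_sum, h Finset.univ]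
    simp
  intro T
  induction T using Finset.induction_on with
  | empty => simp
  | insert a T haT ih =>
    rw [Finset.sum_insert haT, gaussConv_add_apply, ih, gaussConv_blkCov_prod_replicaCopyEven]
    congr 1
    refine Finset.prod_congr rfl fun b _ => ?_
    by_cases hb : b = a
    · subst hb
      rw [if_pos rfl, if_neg haT, if_pos (Finset.mem_insert_self b T)]
    · rw [if_neg hb]
      by_cases hbT : b ∈ T
      · rw [if_pos hbT, if_pos (Finset.mem_insert_of_mem hbT)]
      · rw [if_neg hbT, if_neg (fun h => (Finset.mem_insert.1 h).elim hb hbT)]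

/-! ## §3 The `n`-fold Wick moment formula -/

/-- **`wickMoment_eq_collapse` — the `n`-th Wick moment has only inter-replica contractions**: for even `w_a`,
`e^{Δ_D}(e^{Δ_C}(∏_a e^{−Δ_{D+C}} w_a)) = collapse snd (e^{Δ_{offCov (D+C)}} (∏_a copy_a w_a))`. -/
theorem wickMoment_eq_collapse (C D : Matrix Γ Γ R) (w : Fin n → evenPart R Γ) :
    gaussConv R D (gaussConv R C
      ((∏ a, (⟨gaussConv R (-(D + C)) (w a), (mem_evenPart_iff).2 (gaussConv_mem_evenOdd R _ ((mem_evenPart_iff).1 (w a).2))⟩ :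
        evenPart R Γ) : evenPart R Γ) : GrassmannAlgebra R Γ)) =
      collapse R (Prod.snd : Fin n × Γ → Γ)
        (gaussConv R (offCov R (D + C)) ((∏ a, replicaCopyEven R a (w a) : evenPart R (Fin n × Γ)) : GrassmannAlgebra R (Fin n × Γ))) := by
  -- the Wick-ordered factors
  set w' : Fin n → evenPart R Γ := fun a =>
    ⟨gaussConv R (-(D + C)) (w a), (mem_evenPart_iff).2 (gaussConv_mem_evenOdd R _ ((mem_evenPart_iff).1 (w a).2))⟩ with hw'
  -- lift the product to the replica algebra: `∏ w'_a = collapse (∏ copy_a w'_a)`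
  have hlift : ((∏ a, w' a : evenPart R Γ) : GrassmannAlgebra R Γ) =
      collapse R (Prod.snd : Fin n × Γ → Γ) ((∏ a, replicaCopyEven R a (w' a) : evenPart R (Fin n × Γ)) : GrassmannAlgebra R _) := by
    have h : (∏ a, w' a : evenPart R Γ) = collapseEven R (Prod.snd : Fin n × Γ → Γ) (∏ a, replicaCopyEven R a (w' a)) := by
      rw [map_prod]
      refine Finset.prod_congr rfl fun a _ => Subtype.ext ?_
      rw [coe_collapseEven, coe_replicaCopyEven, collapse_replicaCopy]
    rw [h, coe_collapseEven]
  rw [hlift, ← gaussConv_add_apply, gaussConv_collapse_snd, allCov_eq_diag_add_off, add_comm (diagCov R (D + C)),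
    gaussConv_add_apply, gaussConv_diagCov_prod_replicaCopyEven]
  congr 3
  refine Finset.prod_congr rfl fun a _ => ?_
  congr 1
  exact Subtype.ext (gaussConv_gaussConv_neg_apply R (D + C) (w a))

end Replica

end Summit.HubbardSuperconductivity.HubbardSuperconductivity.Theorems.KLRegimeWick

end
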